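import Mathlib.Data.Fin.Tuple.Basic
import Literature.Computability.Complexity.PEASigmaTwoProgram
import Literature.Computability.Complexity.PEASigmaTwoHashing
import HarnessLib

/-!
# Entropy approximation in `Σ₂ᵖ`, IV: the size of the hashed set `S`

Fourth file of the proof of `PEA d ∈ promiseLift (SigmaP 2)` (program and notation:
`PEASigmaTwoProgram.lean`; affine hashing: `PEASigmaTwoHashing.lean`).  The `M`-bit members of
`S = npSet Q n' k` are triples `(x⃗, A, b)` laid out consecutively (`x⃗ ∈ {0,1}^N`, the `r` rows of
`A`, the `r` bits of `b`); this file identifies that layout with Mathlib's `Fin.append` /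
`Blocks.tupleEquiv` and computes

* `mem_npSet_layout_iff` — `(x⃗, A, b) ∈ S ↔ (A, b) ∈ hitSet r (fibre_T x⃗)`;
* **`card_npSet_eq_sum`** — `|S| = Σ_{Y ∈ (F₂^{n'})^T} |hitSet r (fibre_T Y)|`;
* `card_fibT_eq_prod` — `|fibre_T(Y)| = Πᵢ |fibre(Yᵢ)|` (the product fibre of the `T` samples).

## References

* M. Sipser, STOC 1983, §III, §V.
* Z. Dvir, D. Gutfreund, G. N. Rothblum, S. Vadhan, ECCC TR10-160 (2010), §3.
-/

namespace Literature.Computability.Complexity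

open Finset Blocks SipserHash

namespace PEAHash

/-! ### Reading windows of appended vectors -/

section Windows

variable {N K : ℕ}

/-- `vget` inside the range is the entry. [folklore] -/
theorem vget_of_lt {m : ℕ} (s : Fin m → Bool) {i : ℕ} (hi : i < m) : vget s i = s ⟨i, hi⟩ := by
  simp [vget, hi]

/-- The first `N` bits of `Fin.append x z` are `x`. [folklore] -/
theorem vslice_append_zero (x : Fin N → Bool) (z : Fin K → Bool) :
    vslice (Fin.append x z) 0 N = x := by
  funext c
  simp only [vslice, Nat.zero_add]
  rw [vget_of_lt _ (by omega)]
  have : (⟨(c : ℕ), by omega⟩ : Fin (N + K)) = Fin.castAdd K c := Fin.ext rfl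
  rw [this, Fin.append_left]

/-- A window inside the second part of `Fin.append x z` reads `z`. [folklore] -/
theorem vget_append_right (x : Fin N → Bool) (z : Fin K → Bool) {j : ℕ} (hj : j < K) :
    vget (Fin.append x z) (N + j) = z ⟨j, hj⟩ := by
  rw [vget_of_lt _ (by omega)]
  have : (⟨N + j, by omega⟩ : Fin (N + K)) = Fin.natAdd N ⟨j, hj⟩ := Fin.ext rfl
  rw [this, Fin.append_right]

end Windows

/-! ### The layout `(x⃗, A, b)` of a member of `S` -/

section Layout

variable (Q : List (List (List ℕ))) (n' k : ℕ)

/-- The layout map: `(x⃗, (A, b)) ↦ x⃗ ++ rows of A ++ b`, an equivalence onto the `M`-bit vectors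
(`M = N + (rN + r)`). [folklore] -/
def layout : (Fin (pN n') → Bool) × ((Fin (pR n' k) → Fin (pN n') → Bool) × (Fin (pR n' k) → Bool)) ≃
    (Fin (pM n' k) → Bool) :=
  (Equiv.prodCongr (Equiv.refl _)
      ((Equiv.prodCongr (tupleEquiv (pR n' k) (pN n')) (Equiv.refl _)).trans
        (Fin.appendEquiv (pR n' k * pN n') (pR n' k)))).trans
    (Fin.appendEquiv (pN n') (pR n' k * pN n' + pR n' k))

/-- The layout map, pointwise. [folklore] -/
theorem layout_apply (x : Fin (pN n') → Bool) (A : Fin (pR n' k) → Fin (pN n') → Bool) (b : Fin (pR n' k) → Bool) :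
    layout n' k (x, (A, b)) = Fin.append x (Fin.append (tupleEquiv (pR n' k) (pN n') A) b) := rfl

/-- The `x⃗`-window of a laid-out vector. [folklore] -/
theorem vslice_layout_x (x : Fin (pN n') → Bool) (A : Fin (pR n' k) → Fin (pN n') → Bool) (b : Fin (pR n' k) → Bool) :
    vslice (layout n' k (x, (A, b))) 0 (pT n' * n') = x :=
  vslice_append_zero x _

/-- The row windows of a laid-out vector. [folklore] -/
theorem vslice_layout_row (x : Fin (pN n') → Bool) (A : Fin (pR n' k) → Fin (pN n') → Bool) (b : Fin (pR n' k) → Bool)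
    (ρ : Fin (pR n' k)) :
    vslice (layout n' k (x, (A, b))) (pN n' + ρ * pN n') (pT n' * n') = A ρ := by
  funext c
  simp only [vslice, layout_apply]
  unfold pM
  have hj : (ρ : ℕ) * pN n' + c < pR n' k * pN n' + pR n' k := by
    have h1 : (ρ : ℕ) * pN n' + c < (ρ + 1) * pN n' := by have := c.isLt; simp only [pN] at this ⊢; nlinarith
    have h2 : ((ρ : ℕ) + 1) * pN n' ≤ pR n' k * pN n' := Nat.mul_le_mul_right _ (by have := ρ.isLt; omega)
    omega
  rw [show pN n' + ρ * pN n' + (c : ℕ) = pN n' + (ρ * pN n' + c) by ring, vget_append_right _ _ hj]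
  have : (⟨(ρ : ℕ) * pN n' + c, hj⟩ : Fin (pR n' k * pN n' + pR n' k)) =
      Fin.castAdd (pR n' k) (blkIx ρ c) := Fin.ext (by simp [blkIx_val])
  rw [this, Fin.append_left, tupleEquiv_apply_blkIx]

/-- The `b`-bits of a laid-out vector. [folklore] -/
theorem vget_layout_b (x : Fin (pN n') → Bool) (A : Fin (pR n' k) → Fin (pN n') → Bool) (b : Fin (pR n' k) → Bool)
    (ρ : Fin (pR n' k)) :
    vget (layout n' k (x, (A, b))) (pN n' + pR n' k * pN n' + ρ) = b ρ := by
  rw [layout_apply]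
  unfold pM
  rw [show pN n' + pR n' k * pN n' + (ρ : ℕ) = pN n' + (pR n' k * pN n' + ρ) by ring,
    vget_append_right _ _ (by omega)]
  have : (⟨pR n' k * pN n' + (ρ : ℕ), by omega⟩ : Fin (pR n' k * pN n' + pR n' k)) = Fin.natAdd _ ρ := Fin.ext rfl
  rw [this, Fin.append_right]

/-- **The `T`-sample fibre** of a flat sample vector `x⃗ ∈ {0,1}^{T n'}`: the vectors with the same
values blockwise. (A `Finset`; no new notion.) [cite: DvirGutfreundRothblumVadhan2010, §3 p.6] -/
noncomputable def fibT (x : Fin (pT n' * n') → Bool) : Finset (Fin (pT n' * n') → Bool) :=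
  univ.filter fun w => ∀ i : Fin (pT n'), evalV Q n' (blk w i) = evalV Q n' (blk x i)

/-- Membership in `fibT`. [folklore] -/
@[simp] theorem mem_fibT {x w : Fin (pT n' * n') → Bool} :
    w ∈ fibT Q n' x ↔ ∀ i : Fin (pT n'), evalV Q n' (blk w i) = evalV Q n' (blk x i) := by
  simp [fibT]

/-- **Membership in `S` through the layout**: `(x⃗, A, b) ∈ S` iff the affine hash `(A, b)` hits
the `T`-sample fibre of `x⃗`. [cite: Sipser1983, §III] -/
theorem mem_npSet_layout_iff (x : Fin (pN n') → Bool) (A : Fin (pR n' k) → Fin (pN n') → Bool) (b : Fin (pR n' k) → Bool) :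
    layout n' k (x, (A, b)) ∈ npSet Q n' k ↔ (A, b) ∈ hitSet (pR n' k) (fibT Q n' x) := by
  classical
  unfold npSet
  simp only [mem_filter, mem_univ, true_and, mem_hitSet, mem_fibT]
  simp only [vslice_layout_x, vslice_layout_row, vget_layout_b]
  constructor
  · rintro ⟨w, hw, hh⟩
    exact ⟨w, hw, funext fun ρ => by simpa [hashVal, toZv] using hh ρ⟩
  · rintro ⟨w, hw, hh⟩
    exact ⟨w, hw, fun ρ => by simpa [hashVal, toZv] using congrFun hh ρ⟩

/-- **`|S|` as a sum over the sample vectors**: `|S| = Σ_{x⃗} |hitSet r (fibre_T x⃗)|`. [cite: Sipser1983, §III] -/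
theorem card_npSet_eq_sum_flat :
    (npSet Q n' k).card = ∑ x : Fin (pN n') → Bool, (hitSet (pR n' k) (fibT Q n' x)).card := by
  classical
  -- pull `S` back along the layout equivalence
  have h1 : (npSet Q n' k).card =
      ((univ : Finset ((Fin (pN n') → Bool) × ((Fin (pR n' k) → Fin (pN n') → Bool) × (Fin (pR n' k) → Bool)))).filter
        fun q => q.2 ∈ hitSet (pR n' k) (fibT Q n' q.1)).card := by
    rw [← card_map (layout n' k).toEmbedding]
    congr 1
    ext s
    simp only [mem_map_equiv, mem_filter, mem_univ, true_and]
    obtain ⟨⟨x, A, b⟩, rfl⟩ := (layout n' k).surjective s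
    rw [Equiv.symm_apply_apply]
    exact (mem_npSet_layout_iff Q n' k x A b)
  rw [h1, card_eq_sum_ones, sum_filter, Fintype.sum_prod_type]
  refine sum_congr rfl fun x _ => ?_
  simp only []
  rw [sum_boole, filter_mem_eq_inter, univ_inter, Nat.cast_id]

/-- The same sum indexed by structured sample tuples `Y ∈ (F₂^{n'})^T`. [cite: Sipser1983, §III] -/
theorem card_npSet_eq_sum :
    (npSet Q n' k).card =
      ∑ Y : Fin (pT n') → (Fin n' → Bool), (hitSet (pR n' k) (fibT Q n' (tupleEquiv (pT n') n' Y))).card := by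
  rw [card_npSet_eq_sum_flat]
  exact ((tupleEquiv (pT n') n').sum_comp fun x => (hitSet (pR n' k) (fibT Q n' x)).card).symm

/-- **The product fibre**: `fibre_T (Y₁,…,Y_T)` is the tupling of `Πᵢ fibre(Yᵢ)`. [cite: DvirGutfreundRothblumVadhan2010, §3 p.6] -/
theorem fibT_tupleEquiv_eq_map (Y : Fin (pT n') → (Fin n' → Bool)) :
    fibT Q n' (tupleEquiv (pT n') n' Y) =
      (Fintype.piFinset fun i => fib Q n' (Y i)).map (tupleEquiv (pT n') n').toEmbedding := by
  classical
  ext w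
  simp only [mem_fibT, blk_tupleEquiv, mem_map_equiv, Fintype.mem_piFinset, fib, mem_filter, mem_univ,
    true_and]
  rfl

/-- **`|fibre_T(Y)| = Πᵢ |fibre(Yᵢ)|`.** [cite: DvirGutfreundRothblumVadhan2010, §3 p.6] -/
theorem card_fibT_eq_prod (Y : Fin (pT n') → (Fin n' → Bool)) :
    (fibT Q n' (tupleEquiv (pT n') n' Y)).card = ∏ i, (fib Q n' (Y i)).card := by
  rw [fibT_tupleEquiv_eq_map, card_map, Fintype.card_piFinset]

/-- The product fibre is nonempty (it contains `Y` itself). [folklore] -/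
theorem card_fibT_pos (Y : Fin (pT n') → (Fin n' → Bool)) : 0 < (fibT Q n' (tupleEquiv (pT n') n' Y)).card :=
  card_pos.2 ⟨tupleEquiv (pT n') n' Y, by simp⟩

end Layout

end PEAHash

end Literature.Computability.Complexity
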